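import Mathlib
import Literature.Combinatorics.Enumerative.EntropyBregmanGibbsStep

/-!
# Stub `stub_gibbsStep` (crux stmt-MatrixMultiplication-8303, line bregman-entropy-window)

Crux `Summit.MatrixMultiplication.MatrixMultiplication.Theses.SnSubsetDichotomy.GlobalBranch`, line
`bregman-entropy-window` (lead's skeleton `Cruxes/GlobalBranch/Lines/bregman_entropy_window.lean`),
registered stub `stub_gibbsStep`: the **Gibbs step** of the entropy proof of Brégman's theorem
(Radhakrishnan's random-order chain rule with Gibbs' inequality, as in Cuckler–Kahn) for the
uniform measure on a nonempty `X ⊆ S_n`.  With `N = #X`, `c_{ij} = #{σ' ∈ X : σ' i = j}`, a set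
`B ∌ i` of already revealed rows, `F σ = {σ' ∈ X : σ' = σ on B}`,
`G σ = {σ' ∈ F σ : σ' i = σ i}` and `A σ = {j : σ i' ≠ j for all i' ∈ B}`:

  `∑_{σ ∈ X} (log #F σ - log #G σ)`
  `  ≤ N · ∑_j negMulLog (c_{ij} / N) + ∑_{σ ∈ X} log (∑_{j ∈ A σ} c_{ij} / N)`,

i.e. the conditional entropy of `σ i` given `σ|_B` is at most the entropy `H_i` of the law of `σ i`
plus the expected logarithm of the mass of that law on the still available columns.  The lead
assembles `stub_chainGibbs` from this stub and `stub_chainTelescope`.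

The proof is the `α := Fin n` instance of the general theorem
`Literature.Combinatorics.Enumerative.sum_log_fibre_ratio_le_entropy_add_log_avail` (finite sets of
permutations of a finite type; one global application of `log x ≤ x - 1` plus double counting).
-/

set_option linter.dupNamespace false

namespace Summit.MatrixMultiplication.MatrixMultiplication.Theorems.GlobalBranch

open scoped BigOperators Classical
open Finset

/-- **Stub `stub_gibbsStep` — the Gibbs step of the entropy Brégman chain rule.**  For every `n`,
every nonempty finite set `X` of permutations of `Fin n`, every row `i` and every set `B ∌ i` of
revealed rows: `∑_{σ ∈ X} (log #F σ - log #G σ) ≤ N · H_i + ∑_{σ ∈ X} log P σ`, where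
`F σ = {σ' ∈ X : σ' = σ on B}`, `G σ = {σ' ∈ F σ : σ' i = σ i}`, `N = #X`,
`H_i = ∑_j negMulLog (c_{ij} / N)` with `c_{ij} = #{σ' ∈ X : σ' i = j}`, and
`P σ = ∑_{j not used by σ on B} c_{ij} / N`
(`Literature.Combinatorics.Enumerative.sum_log_fibre_ratio_le_entropy_add_log_avail`).
[cite: Radhakrishnan1997, proof of Thm 1] -/
theorem stub_gibbsStep : ∀ (n : ℕ) (X : Finset (Equiv.Perm (Fin n))) (i : Fin n)
    (B : Finset (Fin n)), X.Nonempty → i ∉ B →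
    ∑ σ ∈ X, (Real.log ((X.filter (fun σ' => ∀ i' ∈ B, σ' i' = σ i')).card : ℝ) -
      Real.log ((X.filter (fun σ' => (∀ i' ∈ B, σ' i' = σ i') ∧ σ' i = σ i)).card : ℝ)) ≤
    (X.card : ℝ) * ∑ j : Fin n, Real.negMulLog (((X.filter (fun σ' => σ' i = j)).card : ℝ) /
      (X.card : ℝ)) + ∑ σ ∈ X, Real.log (∑ j ∈ Finset.univ.filter (fun j => ∀ i' ∈ B, σ i' ≠ j),
        ((X.filter (fun σ' => σ' i = j)).card : ℝ) / (X.card : ℝ)) := by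
  intro n X i B hX hi
  -- `convert`: the statement registered for `Fin n` carries the `Fin`-specific decidability
  -- instances (`Nat.decidableForallFin`), the general theorem the `Fintype` ones.
  convert
    Literature.Combinatorics.Enumerative.sum_log_fibre_ratio_le_entropy_add_log_avail X i B hX hi

end Summit.MatrixMultiplication.MatrixMultiplication.Theorems.GlobalBranch
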